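import Summits.AnomalousDissipation.AnomalousDissipation.Theorems.TwoAndHalfDTwohalfdThesisStubShellNoGo

/-!
# G5 `stub_witnessEnstrophyFloor` — the enstrophy form of the strain gate (line `Sketch`, crux stmt-AnomalousDissipation-0206)

Registered tool stub of the line `Sketch` (duhamel-release) for the crux
`Summit.AnomalousDissipation.AnomalousDissipation.Theses.TwoAndHalfD.TwohalfdThesis`
(stmt-AnomalousDissipation-0206): the mean-ENSTROPHY floor of a released family with a late loss, in the
currency of the single-shell ceiling G3 (`stub_shellEnstrophyBound`, `⟨‖∇v‖₂²⟩ ≤ λE`).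

CONTENT. Classical planar Navier–Stokes drifts `v_j` with a steady smooth mean-zero force `g` and
viscosities `ν_j > 0`, classical releases `φ j s` of one smooth `h` at every `s ≥ 0` losing the fraction `δ`
of `‖h‖²` by age `τ₀ > 0` from every `s ≥ s₀`.  Then there are `κ₀ ∈ (0,1)`, `C > 0` such that for every
`j` with `ν_j ≤ κ₀` whose strain floor `A_j := δ‖h‖² log(1/ν_j)/C − 1` is nonnegative, the honest `limsup`
mean enstrophy obeys `(A_j/τ₀)² ≤ ⟨‖∇v_j‖₂²⟩`: mean planar enstrophy `≳ log²(1/ν_j)/τ₀²` along every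
W-family — the planar, quantitative sharpening of the trivial 3-D enstrophy floor `≥ ε/ν_j` of an
`X`-witness (`Cruxes/TwohalfdThesis/Disproof.lean` §3).

PROOF. G1-W (`releasedFamily_windowStrain_ge`: every late window carries strain `≥ A_j`) and the `liminf`
form of G2 (`windowsToMean_le_longTimeAvgInf_of_isBoundedUnder`) give `liminf_T ⟨‖∇v_j‖₂⟩_T ≥ A_j/τ₀`
(honest: the running means of the strain are bounded for a global Leray–Hopf flow under a mean-zero force);
Jensen `⟨‖∇v‖₂⟩_T² ≤ ⟨‖∇v‖₂²⟩_T` (`timeMean_sqrt_le_sqrt_timeMean`) then bounds the running means of the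
enstrophy below eventually, and their boundedness (`IsGlobalLerayHopf.isBoundedUnder_timeMean_dissipation`)
makes the `limsup` honest.  Supports stmt-AnomalousDissipation-0206. [folklore]
-/

noncomputable section

-- the summit path `AnomalousDissipation/AnomalousDissipation` duplicates a namespace component
set_option linter.dupNamespace false

namespace Summit.AnomalousDissipation.AnomalousDissipation.Theorems.TwohalfdThesis

open MeasureTheory Set Filter Topology
open scoped ENNReal NNReal InnerProductSpace
open Literature.Analysis.FunctionSpaces Literature.Analysis.FluidPDE
open Summit.AnomalousDissipation.AnomalousDissipation.Theorems.TwohalfdNeg.QuietOfSubLog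

/-- Local notation: the flat two-torus. -/
local notation "𝕋²" => UnitAddTorus (Fin 2)
/-- Local notation: planar velocity values. -/
local notation "E²" => EuclideanSpace ℝ (Fin 2)

/-- **Bounded running means of the enstrophy** along a global Leray–Hopf solution with steady mean-zero
force `g ∈ L²` and `ν > 0` (`IsGlobalLerayHopf.isBoundedUnder_timeMean_dissipation` divided by `ν`). [folklore] -/
theorem isBoundedUnder_timeMean_eGradNormSq {ν' : ℝ} {g' v₀' : 𝕋² → E²} {v' : ℝ → 𝕋² → E²}
    (hν' : 0 < ν') (hg' : MemLp g' 2 volume) (hgz' : Torus.HasZeroMean g')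
    (hLH : Torus.IsGlobalLerayHopf ν' (fun _ => g') v₀' v') :
    IsBoundedUnder (· ≤ ·) atTop (timeMean fun t => (Torus.eGradNormSq (v' t)).toReal) := by
  obtain ⟨b, hb⟩ := hLH.isBoundedUnder_timeMean_dissipation hν' hg' hgz'
  refine ⟨b / ν', ?_⟩
  rw [eventually_map] at hb ⊢
  filter_upwards [hb] with T hT
  rw [timeMean_const_mul] at hT
  rw [le_div_iff₀ hν']
  linarith [mul_comm ν' (timeMean (fun t => (Torus.eGradNormSq (v' t)).toReal) T)]

/-- **From a `liminf` strain floor to a `limsup` enstrophy floor (Jensen).**  Along a global Leray–Hopf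
solution with steady mean-zero force and `ν > 0`: if `a ≤ liminf_T ⟨‖∇v‖₂⟩_T` with `a ≥ 0`, then
`a² ≤ ⟨‖∇v‖₂²⟩` (the honest `limsup` mean enstrophy). [folklore] -/
theorem sq_le_longTimeAvgSup_eGradNormSq_of_le_longTimeAvgInf {ν' : ℝ} {g' v₀' : 𝕋² → E²}
    {v' : ℝ → 𝕋² → E²} (hν' : 0 < ν') (hg' : MemLp g' 2 volume) (hgz' : Torus.HasZeroMean g')
    (hLH : Torus.IsGlobalLerayHopf ν' (fun _ => g') v₀' v') {a : ℝ} (ha : 0 ≤ a)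
    (hinf : a ≤ longTimeAvgInf (fun t => Real.sqrt (Torus.eGradNormSq (v' t)).toReal)) :
    a ^ 2 ≤ longTimeAvgSup (fun t => (Torus.eGradNormSq (v' t)).toReal) := by
  set Z : ℝ → ℝ := fun t => (Torus.eGradNormSq (v' t)).toReal with hZdef
  set ψ : ℝ → ℝ := fun t => Real.sqrt (Z t) with hψdef
  have hZ0 : ∀ t, 0 ≤ Z t := fun t => ENNReal.toReal_nonneg
  have hψ0 : ∀ t, 0 ≤ ψ t := fun t => Real.sqrt_nonneg _
  have hbZ : IsBoundedUnder (· ≤ ·) atTop (timeMean Z) := isBoundedUnder_timeMean_eGradNormSq hν' hg' hgz' hLH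
  -- the running means of `ψ` are bounded below by `0`
  have hψlow : IsBoundedUnder (· ≥ ·) atTop (timeMean ψ) :=
    isBoundedUnder_of_eventually_ge ((eventually_ge_atTop (0 : ℝ)).mono fun T hT => timeMean_nonneg hψ0 hT)
  -- it suffices to prove `(a - η)² ≤ limsup` for every small `η > 0`
  rcases eq_or_lt_of_le ha with ha0 | ha0
  · rw [← ha0]
    simpa using longTimeAvgSup_nonneg hZ0
  have hkey : ∀ η, 0 < η → η < a → (a - η) ^ 2 ≤ longTimeAvgSup Z := by
    intro η hη hηa
    have hlt : a - η < liminf (timeMean ψ) atTop := by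
      have : longTimeAvgInf ψ = liminf (timeMean ψ) atTop := rfl
      linarith [hinf]
    have hev : ∀ᶠ T in atTop, a - η < timeMean ψ T := eventually_lt_of_lt_liminf hlt hψlow
    have hev2 : ∀ᶠ T in atTop, (a - η) ^ 2 ≤ timeMean Z T := by
      filter_upwards [hev, eventually_gt_atTop (0 : ℝ)] with T hT hT0
      have hZi : IntegrableOn Z (Ioc 0 T) := by
        rw [integrableOn_Ioc_iff_integrableOn_Ioo]
        exact integrable_toReal_of_lintegral_ne_top (hLH T hT0).aemeasurable_eGradNormSq
          (hLH T hT0).lintegral_eGradNormSq_lt_top.ne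
      have hJ : timeMean ψ T ≤ Real.sqrt (timeMean Z T) := timeMean_sqrt_le_sqrt_timeMean hT0 hZ0 hZi
      have hm0 : 0 ≤ timeMean Z T := timeMean_nonneg hZ0 hT0.le
      have h1 : 0 ≤ a - η := by linarith
      calc (a - η) ^ 2 ≤ (timeMean ψ T) ^ 2 := by
            exact pow_le_pow_left₀ h1 hT.le 2
        _ ≤ (Real.sqrt (timeMean Z T)) ^ 2 :=
            pow_le_pow_left₀ (timeMean_nonneg hψ0 hT0.le) hJ 2
        _ = timeMean Z T := Real.sq_sqrt hm0
    exact le_limsup_of_frequently_le hev2.frequently hbZ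
  -- let `η → 0⁺`
  have hcont : Tendsto (fun η : ℝ => (a - η) ^ 2) (𝓝[>] 0) (𝓝 ((a - 0) ^ 2)) :=
    ((continuous_const.sub continuous_id).pow 2).continuousAt.tendsto.mono_left nhdsWithin_le_nhds
  rw [sub_zero] at hcont
  have hev : ∀ᶠ η in 𝓝[>] (0 : ℝ), (a - η) ^ 2 ≤ longTimeAvgSup Z := by
    have h1 : ∀ᶠ η in 𝓝[>] (0 : ℝ), η < a := by
      have : Iio a ∈ 𝓝 (0 : ℝ) := Iio_mem_nhds ha0
      exact mem_nhdsWithin_of_mem_nhds this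
    have h2 : ∀ᶠ η in 𝓝[>] (0 : ℝ), 0 < η := self_mem_nhdsWithin
    filter_upwards [h1, h2] with η hη1 hη2 using hkey η hη2 hη1
  exact le_of_tendsto hcont hev

/-- **G5 `stub_witnessEnstrophyFloor` (line `Sketch` = duhamel-release, crux `TwoAndHalfD.TwohalfdThesis`; registered
signature): the mean-ENSTROPHY floor of a released family with a late loss** — `(A_j/τ₀)² ≤ ⟨‖∇v_j‖₂²⟩` for every
`j` with `ν_j ≤ κ₀` and `A_j = δ‖h‖² log(1/ν_j)/C − 1 ≥ 0` (G1-W + the `liminf` form of G2 + Jensen). [folklore] -/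
theorem stub_witnessEnstrophyFloor :
    ∀ (ν : ℕ → ℝ) (g : (UnitAddTorus (Fin 2)) → (EuclideanSpace ℝ (Fin 2))) (v : ℕ → ℝ → (UnitAddTorus (Fin 2)) → (EuclideanSpace ℝ (Fin 2))) (p : ℕ → ℝ → (UnitAddTorus (Fin 2)) → ℝ) (h : (UnitAddTorus (Fin 2)) → ℝ) (φ : ℕ → ℝ → ℝ → (UnitAddTorus (Fin 2)) → ℝ) (s₀ τ₀ δ : ℝ),
      (∀ j, 0 < ν j) → Torus.IsSmooth g → Torus.HasZeroMean g →
      (∀ j, Torus.IsClassicalNSSolutionOn (Ici 0) (ν j) (fun _ => g) (v j) (p j)) →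
      Torus.IsSmooth h → 0 < τ₀ →
      (∀ j s, 0 ≤ s → Torus.IsClassicalScalarTransportOn (Ici s) (ν j) (v j) (φ j s) ∧ φ j s s = h) →
      0 ≤ s₀ →
      (∀ j s, s₀ ≤ s → Torus.scalarL2Sq (φ j s (s + τ₀)) ≤ (1 - δ) * Torus.scalarL2Sq h) →
      ∃ κ₀ C : ℝ, 0 < κ₀ ∧ κ₀ < 1 ∧ 0 < C ∧ ∀ j, ν j ≤ κ₀ →
        0 ≤ δ * Torus.scalarL2Sq h * Real.log (ν j)⁻¹ / C - 1 →
        ((δ * Torus.scalarL2Sq h * Real.log (ν j)⁻¹ / C - 1) / τ₀) ^ 2 ≤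
          longTimeAvgSup (fun t => (Torus.eGradNormSq (v j t)).toReal) := by
  intro ν g v p h φ s₀ τ₀ δ hν hg hgz hNS hh hτ₀ hrel hs₀ hloss
  obtain ⟨κ₀, C, hκ₀, hκ₀1, hC, hwin⟩ := releasedFamily_windowStrain_ge hν hh hτ₀ hrel hs₀ hloss
  refine ⟨κ₀, C, hκ₀, hκ₀1, hC, fun j hj hA0 => ?_⟩
  set A : ℝ := δ * Torus.scalarL2Sq h * Real.log (ν j)⁻¹ / C - 1 with hA
  have hLH := isGlobalLerayHopf_of_isClassicalNSSolutionOn_Ici (hNS j)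
  set Φ : ℝ → ℝ≥0∞ := fun t => Torus.eGradNormSq (v j t) ^ (1 / 2 : ℝ) with hΦ
  set ψ : ℝ → ℝ := fun t => Real.sqrt (Torus.eGradNormSq (v j t)).toReal with hψ
  have hΦψ : (fun t => (Φ t).toReal) = ψ := by
    funext t
    simp only [hΦ, hψ]
    rw [← ENNReal.toReal_rpow, Real.sqrt_eq_rpow]
  have hmeas : AEMeasurable Φ (volume.restrict (Ioi 0)) := (aemeasurable_eGradNormSq_Ioi hLH).pow_const _
  have hfin : ∀ T, 0 < T → ∫⁻ t in Ioo 0 T, Φ t < ⊤ := fun T hT =>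
    lintegral_rpow_half_eGradNormSq_lt_top hLH hT
  have hbdd : IsBoundedUnder (· ≤ ·) atTop (timeMean fun t => (Φ t).toReal) := by
    rw [hΦψ]
    exact isBoundedUnder_timeMean_sqrt_eGradNormSq hLH (hν j) (hg.memLp 2) hgz
  have hinf := windowsToMean_le_longTimeAvgInf_of_isBoundedUnder hmeas hfin hA0 hτ₀ hs₀
    (fun s hs => hwin j hj s hs) hbdd
  rw [hΦψ] at hinf
  exact sq_le_longTimeAvgSup_eGradNormSq_of_le_longTimeAvgInf (hν j) (hg.memLp 2) hgz hLH
    (div_nonneg hA0 hτ₀.le) hinf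

end Summit.AnomalousDissipation.AnomalousDissipation.Theorems.TwohalfdThesis

end
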